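import Mathlib
import HarnessLib
import Summits.HubbardSuperconductivity.HubbardSuperconductivity.Theorems.KLProgrammeKLRegimeEngineTowerLevNumericsBlockZero

/-!
# Route `KLProgramme` — crux K3 ENGINE (stmt-HubbardSuperconductivity-20437 `KLRegimeEngineV17F2`), stub (b) v2, THE LEVELS PACKAGE (ℓ), numerics side
# «(ℓ)-NUMERICS» part 6a (cell gate-hubbard-kl, seat p4 g22): BLOCK 0's NUMERICS PACKAGE KEYED ON p3's `kernelNormsLevels_all_klEng_numerics` (p704093) —
# the two-leg slot as a PRODUCT BOUND `ι₁₀·λ ≤ (M/β)/Bf` (the level-0 two-leg budget is `O(|U| + c)`, not `O(λ)`), no `i₁₀`-door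

p3 g22's hypothesis-minimal (ℓ) head `…_numerics` replaces block `0`'s kit-currency rows by five inequalities in the level-`0` datum constants `(A₁, P₁, T₁)`:
`W₀·27⁵·Ab₀ ≤ A′₀`, `Z₀·Qb₀ ≤ Q′₀`, `W₀Z₀³(27⁵Ab₀Qb₀³) ≤ ι₃₀`, `W₀Z₀·27⁵·T₁(|U| + c)/ε_x ≤ ι₁₀·(Bε₁)`, `W₀Z₀²·27⁵·A₁P₁²|U|/ε_x³ ≤ ι₂₀·(Bε₁)`.  With the pins
`A′₀ := 27⁵W₀Ab₀`, `Q′₀ := Z₀Qb₀ + 1`, `ι₃₀ := A′₀Q′₀³` and `Ab₀ = ab₀·(β/M)/Bf²` (ab₀ = A₁/(2Klam²)), `Qb₀ = qb₀·(M/β)²` (qb₀ = 4P₁) the four-leg slot has the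
packageZ shape `ι₂₀ ≤ i₂₀·(M/β)³/Bf` (i₂₀ = 8·27⁵W₀Z₀²A₁P₁²/Klam), but the TWO-LEG slot is NOT proportional to the coupling: at the block-`0` levels `j ≤ d` one has
`ι₁₀·λ_j = W₀Z₀27⁵T₁(|U| + c)(ε_j/ε_1)/ε_x ≤ G·(|U| + c)·(M/β)`, `G = 2·27⁵W₀Z₀T₁(1 + d)`, which the GLUE makes `≤ (M/β)/Bf` by the doors `|U|, c ≤ 1/(2·G·Bf + 1)`.
So this twin of `levNumerics_packageZ` (…TowerLevNumericsPackageZ) takes, per coupling `λ`, a free `ι₁₀ ≥ 0` with the PRODUCT BOUND `ι₁₀·λ ≤ (M/β)/Bf` in place of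
`ι₁₀′ = ι₁₀/Bf ≤ i₁₀(M/β)/Bf`; the two-leg contributions are then absorbed by `Bf ≥ 4e·φ₀₀t₀₀·(1 + ŝC₀)` (no `i₁₀`-door), `Θ₀` loses its two-leg term, and
`aT = Cinc·(ab₀ + aP₀ + e·φ₀₀t₀₀·(1 + ŝC₀)²/QL₀)`.  Helper variants `levNum_S₀_le'`, `levNum_θ₀_le'` (product-bound two-leg slot) precede the package.
**`levNumerics_packageZN`**: `0 < uf₀ ∧ 0 < aT₁ ∧ 0 < qT₁ ∧ 0 ≤ CEf₀` and, for all `0 < β ≤ M` and the shaped data/pins: (o) signs; (i) the FIVE STRICT SMALLNESS ROWS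
for every `0 ≤ λ ≤ uf₀` and every `ι₁₀ ≥ 0` with `ι₁₀λ ≤ (M/β)/Bf`; (ii) the CE₀ row; (iii) the DOMINATION `Atot₁(λ) ≤ aT₁·(β/M)/Bf²`, `Qtot₁ ≤ qT₁·(M/β)²`.
Pure real arithmetic; nothing about the model is asserted; nothing asserts (ℓ), any stub, K3 or superconductivity.
References: BGM 2006 §2.8 (2.83)–(2.84), (2.93)–(2.98), Lemma 2.5 (2.98) [cite: BenfattoGiulianiMastropietro2006].
-/

noncomputable section

namespace Summit.HubbardSuperconductivity.HubbardSuperconductivity.Theorems.EngineV8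

set_option linter.dupNamespace false -- summit = problem name (single-conjunct summit), D-0017

open Real Literature.MathematicalPhysics.QuantumLattice
open Summit.HubbardSuperconductivity.HubbardSuperconductivity.Theorems.KLRegimeSplit

/-! ## Two helpers: the re-summed size and the θ-row with a PRODUCT bound on the two-leg slot -/

section ProductSlot

variable {r t₀ φ₀ τ Φ Q' QL QH B lam ι₁ ι₂ ι₃ A' g i₂ i₃ aP : ℝ}

/-- `levNum_S₀_le` with the two-leg slot bounded as a product: `ι₁·λ ≤ g/(B·r)`. [folklore] -/
theorem levNum_S₀_le' (hr : 0 < r) (hB : 1 ≤ B) (hQL : 0 < QL) (hlam : 0 ≤ lam) (hι₁ : ι₁ * lam ≤ g / (B * r)) (hι₂0 : 0 ≤ ι₂)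
    (hι₂ : ι₂ ≤ i₂ / (B * r ^ 3)) (hι₃0 : 0 ≤ ι₃) (hι₃ : ι₃ ≤ i₃ / (B ^ 2 * r ^ 5)) (hA'0 : 0 ≤ A') (hA' : A' ≤ aP * r / B ^ 2)
    (hQ'₁ : QL / r ^ 2 ≤ Q') (hQ'₂ : Q' ≤ QH / r ^ 2) :
    ι₁ * lam + ι₂ / (2 * Q') + ι₃ / (4 * Q' ^ 2) + A' * Q' / 4 ≤ (g + i₂ / (2 * QL) + i₃ / (4 * QL ^ 2) + aP * QH / 4) / (B * r) := by
  have h0 := levNum_S₀_le (ι₁ := 0) (i₁ := 0) hr hB hQL hlam (by rw [zero_div]) hι₂0 hι₂ hι₃0 hι₃ hA'0 hA' hQ'₁ hQ'₂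
  rw [zero_mul, zero_add, zero_add] at h0
  calc ι₁ * lam + ι₂ / (2 * Q') + ι₃ / (4 * Q' ^ 2) + A' * Q' / 4 = ι₁ * lam + (ι₂ / (2 * Q') + ι₃ / (4 * Q' ^ 2) + A' * Q' / 4) := by ring
    _ ≤ g / (B * r) + (i₂ / (2 * QL) + i₃ / (4 * QL ^ 2) + aP * QH / 4) / (B * r) := add_le_add hι₁ h0
    _ = _ := by ring

/-- `levNum_θ₀_le` with the two-leg slot bounded as a product `ι₁·λ ≤ g/r`: the θ-row value is `≤ e·φ₀t₀·g + λ·Θ′`,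
`Θ′ := e²φ₀t₀²i₂ + e³φ₀t₀³i₃ + e³φ₀t₀³aP·QH³`, hence `≤ 1/2` once `e·φ₀t₀·g ≤ 1/4` and `λ ≤ 1/(4Θ′ + 1)`. [folklore] -/
theorem levNum_θ₀_le' (hr : 0 < r) (ht₀ : 0 ≤ t₀) (hφ₀ : 0 ≤ φ₀) (hΦ : Φ = φ₀ / r) (hτ : τ = t₀ * r ^ 2)
    (hι₁0 : 0 ≤ ι₁) (hι₁ : ι₁ * lam ≤ g / r) (hι₂0 : 0 ≤ ι₂) (hι₂ : ι₂ ≤ i₂ / r ^ 3) (hι₃0 : 0 ≤ ι₃) (hι₃ : ι₃ ≤ i₃ / r ^ 5)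
    (hA'0 : 0 ≤ A') (hA' : A' ≤ aP * r) (hQ'0 : 0 < Q') (hQ'₂ : Q' ≤ QH / r ^ 2) (hlam0 : 0 ≤ lam) (hlam1 : lam ≤ 1)
    (hx₃ : exp 1 * τ * lam * Q' ≤ 1 / 2) {Θ : ℝ}
    (hΘ : Θ = exp 1 ^ 2 * φ₀ * t₀ ^ 2 * i₂ + exp 1 ^ 3 * φ₀ * t₀ ^ 3 * i₃ + exp 1 ^ 3 * φ₀ * t₀ ^ 3 * aP * QH ^ 3) :
    0 ≤ Φ * (exp 1 * τ * (ι₁ * lam) + (exp 1 * τ) ^ 2 * (ι₂ * lam) + (exp 1 * τ) ^ 3 * (ι₃ * lam ^ 2) +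
        A' * (exp 1 * τ * Q') * ((exp 1 * τ * lam * Q') ^ 3 / (1 - exp 1 * τ * lam * Q'))) ∧
      Φ * (exp 1 * τ * (ι₁ * lam) + (exp 1 * τ) ^ 2 * (ι₂ * lam) + (exp 1 * τ) ^ 3 * (ι₃ * lam ^ 2) +
        A' * (exp 1 * τ * Q') * ((exp 1 * τ * lam * Q') ^ 3 / (1 - exp 1 * τ * lam * Q'))) ≤ exp 1 * φ₀ * t₀ * g + lam * Θ ∧
      (exp 1 * φ₀ * t₀ * g ≤ 1 / 4 → lam ≤ 1 / (4 * Θ + 1) →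
        Φ * (exp 1 * τ * (ι₁ * lam) + (exp 1 * τ) ^ 2 * (ι₂ * lam) + (exp 1 * τ) ^ 3 * (ι₃ * lam ^ 2) +
          A' * (exp 1 * τ * Q') * ((exp 1 * τ * lam * Q') ^ 3 / (1 - exp 1 * τ * lam * Q'))) ≤ 1 / 2) := by
  -- the θ-row with the two-leg slot zeroed, from `levNum_θ₀_le` at `ι₁ := 0`
  have hΦ0 : 0 ≤ Φ := by rw [hΦ]; positivity
  have hτ0 : 0 ≤ τ := by rw [hτ]; positivity
  obtain ⟨h00, h0, -⟩ := levNum_θ₀_le (ι₁ := 0) (i₁ := 0) (Θ := exp 1 * φ₀ * t₀ * 0 + Θ) hr ht₀ hφ₀ hΦ hτ le_rfl (by rw [zero_div]) hι₂0 hι₂ hι₃0 hι₃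
    hA'0 hA' hQ'0 hQ'₂ hlam0 hlam1 hx₃ (by rw [hΘ]; ring)
  have hg : 0 ≤ g := by
    have h := (mul_nonneg hι₁0 hlam0).trans hι₁
    exact (div_nonneg_iff.1 h).elim (fun h' => h'.1) fun h' => absurd h'.2 (not_le.2 hr)
  have hΘ0 : 0 ≤ Θ := by
    have hi₂ : 0 ≤ i₂ := by
      have h := hι₂0.trans hι₂; rwa [le_div_iff₀ (by positivity), zero_mul] at h
    have hi₃ : 0 ≤ i₃ := by
      have h := hι₃0.trans hι₃; rwa [le_div_iff₀ (by positivity), zero_mul] at h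
    have haP : 0 ≤ aP := (mul_nonneg_iff_of_pos_right hr).1 (hA'0.trans hA')
    have hQH : 0 ≤ QH := by
      have h := hQ'0.le.trans hQ'₂; rwa [le_div_iff₀ (by positivity), zero_mul] at h
    rw [hΘ]; positivity
  -- the two-leg term
  have e1 : Φ * (exp 1 * τ * (ι₁ * lam)) = exp 1 * φ₀ * t₀ * (ι₁ * lam * r) := by rw [hΦ, hτ]; field_simp
  have h1 : Φ * (exp 1 * τ * (ι₁ * lam)) ≤ exp 1 * φ₀ * t₀ * g := by
    rw [e1]; gcongr; exact (le_div_iff₀ hr).1 hι₁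
  have hsplit : Φ * (exp 1 * τ * (ι₁ * lam) + (exp 1 * τ) ^ 2 * (ι₂ * lam) + (exp 1 * τ) ^ 3 * (ι₃ * lam ^ 2) +
      A' * (exp 1 * τ * Q') * ((exp 1 * τ * lam * Q') ^ 3 / (1 - exp 1 * τ * lam * Q'))) =
      Φ * (exp 1 * τ * (ι₁ * lam)) + Φ * (exp 1 * τ * (0 * lam) + (exp 1 * τ) ^ 2 * (ι₂ * lam) + (exp 1 * τ) ^ 3 * (ι₃ * lam ^ 2) +
        A' * (exp 1 * τ * Q') * ((exp 1 * τ * lam * Q') ^ 3 / (1 - exp 1 * τ * lam * Q'))) := by ring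
  have hmain : Φ * (exp 1 * τ * (ι₁ * lam) + (exp 1 * τ) ^ 2 * (ι₂ * lam) + (exp 1 * τ) ^ 3 * (ι₃ * lam ^ 2) +
      A' * (exp 1 * τ * Q') * ((exp 1 * τ * lam * Q') ^ 3 / (1 - exp 1 * τ * lam * Q'))) ≤ exp 1 * φ₀ * t₀ * g + lam * Θ := by
    rw [hsplit]
    have h0' : Φ * (exp 1 * τ * (0 * lam) + (exp 1 * τ) ^ 2 * (ι₂ * lam) + (exp 1 * τ) ^ 3 * (ι₃ * lam ^ 2) +
        A' * (exp 1 * τ * Q') * ((exp 1 * τ * lam * Q') ^ 3 / (1 - exp 1 * τ * lam * Q'))) ≤ lam * Θ := by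
      refine h0.trans (le_of_eq ?_); ring
    linarith
  refine ⟨?_, hmain, fun hg4 hlamΘ => hmain.trans ?_⟩
  · have : 0 ≤ Φ * (exp 1 * τ * (ι₁ * lam)) := by positivity
    rw [hsplit]; linarith
  · have hl : lam * Θ ≤ 1 / 4 := by
      calc lam * Θ ≤ 1 / (4 * Θ + 1) * Θ := mul_le_mul_of_nonneg_right hlamΘ hΘ0
        _ ≤ 1 / 4 := by rw [one_div_mul_eq_div, div_le_iff₀ (by positivity)]; linarith
    linarith

end ProductSlot

set_option maxHeartbeats 1600000 in -- one ~50-binder statement with ~20 closed forms and four long conclusions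
/-- **BLOCK 0's NUMERICS PACKAGE, PRODUCT-BOUND TWO-LEG SLOT** (see the module docstring for the closed forms and the conclusions (o)–(iii)).
[cite: BenfattoGiulianiMastropietro2006, §2.8 (2.83)-(2.84), (2.93)-(2.98), Lemma 2.5 (2.98)] -/
theorem levNumerics_packageZN
    {Cinc₀ Dinc₀ Cinc₁ Dinc₁ Cκ₀ Cb₀ CJ₀ ab₀ qb₀ i₂₀ : ℝ} {d : ℕ}
    (hCinc₀ : 0 < Cinc₀) (hDinc₀ : 1 ≤ Dinc₀) (hCinc₁ : 1 ≤ Cinc₁) (hDinc₁ : 1 ≤ Dinc₁) (hCκ₀ : 0 < Cκ₀) (hCb₀ : 0 < Cb₀) (hCJ₀ : 0 < CJ₀)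
    (hab₀ : 0 < ab₀) (hqb₀ : 0 < qb₀) (hi₂₀ : 0 ≤ i₂₀)
    -- the r-free closed forms (instantiate with `rfl`)
    {W₀₀ Z₀₀ s₀₀ t₀₀ p₀₀ φ₀₀ QL₀ QH₀ aP₀ sC₀ Θ₀ uf₀ aT₀ aT₁ qT₀ qT₁ CEf₀ : ℝ} {Bf : ℝ}
    (hW₀₀ : W₀₀ = 32 * (27 : ℝ) ^ 4 * exp 2) (hZ₀₀ : Z₀₀ = exp 4 * (81 * CJ₀) ^ 2 / 8)
    (hs₀₀ : s₀₀ = 2 * Cκ₀ * klE0 / (exp 4 * 162 ^ 2 * CJ₀ ^ 2)) (ht₀₀ : t₀₀ = exp 2 * (2 * Cκ₀ * klE0) / (162 ^ 2 * CJ₀ ^ 2))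
    (hp₀₀ : p₀₀ = exp 4 * 162 ^ 2 * CJ₀ ^ 2 / (2 * Cκ₀ * klE0)) (hφ₀₀ : φ₀₀ = 9 * Cb₀ * (4 : ℝ) ^ d / ((27 : ℝ) ^ 5 * exp 1 * Cκ₀ * klE0 ^ 2))
    (hQL₀ : QL₀ = Z₀₀ * qb₀) (hQH₀ : QH₀ = Z₀₀ * qb₀ + 1) (haP₀ : aP₀ = (27 : ℝ) ^ 5 * W₀₀ * ab₀)
    (hsC₀ : sC₀ = i₂₀ / (2 * QL₀) + aP₀ * QH₀ ^ 3 / (4 * QL₀ ^ 2) + aP₀ * QH₀ / 4)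
    (hΘ₀ : Θ₀ = exp 1 ^ 2 * φ₀₀ * t₀₀ ^ 2 * i₂₀ + exp 1 ^ 3 * φ₀₀ * t₀₀ ^ 3 * (aP₀ * QH₀ ^ 3) + exp 1 ^ 3 * φ₀₀ * t₀₀ ^ 3 * aP₀ * QH₀ ^ 3)
    (huf₀ : uf₀ = min 1 (min (1 / (8 * s₀₀ * QH₀ + 1)) (min (1 / (2 * exp 1 * t₀₀ * QH₀ + 1)) (1 / (4 * Θ₀ + 1)))))
    (haT₀ : aT₀ = Cinc₀ * (ab₀ + aP₀ + exp 1 * φ₀₀ * t₀₀ * (1 + sC₀) ^ 2 / QL₀))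
    (haT₁ : aT₁ = Cinc₁ * (ab₀ + aP₀ + exp 1 * φ₀₀ * t₀₀ * (1 + sC₀) ^ 2 / QL₀))
    (hqT₀ : qT₀ = Dinc₀ * (1 + Dinc₀ * qb₀ + 4 * QH₀ + 2 * t₀₀ * p₀₀ * QH₀) / 4)
    (hqT₁ : qT₁ = Dinc₁ * (1 + Dinc₁ * qb₀ + 4 * QH₀ + 2 * t₀₀ * p₀₀ * QH₀))
    (hCEf₀ : CEf₀ = qT₀ * Bf * max 1 (2 * aT₀))
    -- ANY `Bf` above block 0's threshold (it also absorbs the two-leg slot)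
    (hBf1 : 1 ≤ Bf) (hBf₀ : 4 * exp 1 * φ₀₀ * t₀₀ * (1 + sC₀) ≤ Bf) :
    0 < uf₀ ∧ 0 < aT₁ ∧ 0 < qT₁ ∧ 0 ≤ CEf₀ ∧
    ∀ (β : ℝ) (M : ℕ) [NeZero M], 0 < β → β ≤ M →
    -- the level-0 datum SHAPES and the four-leg slot ON ITS SHAPE (already carrying its `1/Bf`)
    ∀ (Ab₀ Qb₀ ι₂₀ : ℝ), Ab₀ = ab₀ * (β / M) / Bf ^ 2 → Qb₀ = qb₀ * ((M : ℝ) / β) ^ 2 → 0 ≤ ι₂₀ → ι₂₀ ≤ i₂₀ * ((M : ℝ) / β) ^ 3 / Bf →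
    -- block 0's KlEng link pins and the law's six names (equational)
    ∀ (κb₀ αb₀ crb₀ ccb₀ : ℝ), κb₀ = Real.sqrt (2 * Cκ₀ * klE0) → αb₀ = Cb₀ * ((M : ℝ) / β) * (4 : ℝ) ^ d / klE0 →
      crb₀ = 81 * CJ₀ * M / β → ccb₀ = 162 * CJ₀ * M / β →
    ∀ (W₀ Z₀ σ₀ Φ₀ ψ₀ τ₀ : ℝ), W₀ = 64 * (27 : ℝ) ^ 4 * exp 2 * crb₀ / ccb₀ → Z₀ = exp 4 * ccb₀ ^ 2 * imagTimeWeight β M ^ 2 / 8 →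
      σ₀ = κb₀ ^ 2 / (exp 4 * ccb₀ ^ 2) → Φ₀ = 9 * αb₀ * ccb₀ / ((27 : ℝ) ^ 5 * exp 1 * κb₀ ^ 2 * crb₀) → ψ₀ = exp 4 * ccb₀ ^ 2 / κb₀ ^ 2 →
      τ₀ = exp 2 * κb₀ ^ 2 / ccb₀ ^ 2 →
    -- the Chernoff profile PINNED on the datum (equational)
    ∀ (A'₀ Q'₀ ι₃₀ : ℝ), A'₀ = (27 : ℝ) ^ 5 * W₀ * Ab₀ → Q'₀ = Z₀ * Qb₀ + 1 → ι₃₀ = A'₀ * Q'₀ ^ 3 →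
    -- (o) signs
    (0 ≤ Ab₀ ∧ 0 ≤ Qb₀ ∧ 0 ≤ A'₀ ∧ 0 < Q'₀ ∧ Z₀ * Qb₀ ≤ Q'₀ ∧ 0 ≤ ι₃₀ ∧ Z₀ ^ 3 * Qb₀ ^ 3 ≤ Q'₀ ^ 3 ∧ 0 ≤ Φ₀ ∧ 0 ≤ τ₀ ∧ 0 < W₀ ∧ 0 < Z₀) ∧
    -- (i) the five STRICT smallness rows at every coupling below `uf₀`, for every two-leg slot within the product bound
    (∀ lam ι₁₀' : ℝ, 0 ≤ lam → lam ≤ uf₀ → 0 ≤ ι₁₀' → ι₁₀' * lam ≤ ((M : ℝ) / β) / Bf →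
      4 * σ₀ * lam * Q'₀ < 1 ∧ 2 * lam * τ₀ * Q'₀ ≤ 1 ∧ exp 1 * τ₀ * lam * Q'₀ < 1 ∧
      Φ₀ * (τ₀ * (ι₁₀' * lam + ι₂₀ / (2 * Q'₀) + ι₃₀ / (4 * Q'₀ ^ 2) + A'₀ * Q'₀ / 4)) < 1 ∧
      Φ₀ * (exp 1 * τ₀ * (ι₁₀' * lam) + (exp 1 * τ₀) ^ 2 * (ι₂₀ * lam) + (exp 1 * τ₀) ^ 3 * (ι₃₀ * lam ^ 2) +
        A'₀ * (exp 1 * τ₀ * Q'₀) * ((exp 1 * τ₀ * lam * Q'₀) ^ 3 / (1 - exp 1 * τ₀ * lam * Q'₀))) < 1) ∧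
    -- (ii) the CE row of the levels `1 ≤ j < d` (constants `Cinc₀ Dinc₀`)
    (∀ lam ι₁₀' : ℝ, 0 ≤ lam → lam ≤ uf₀ → 0 ≤ ι₁₀' → ι₁₀' * lam ≤ ((M : ℝ) / β) / Bf → ∀ (Aro Qro Qtot Atot : ℝ), Aro = Cinc₀ * Ab₀ → Qro = Dinc₀ * Qb₀ →
      Qtot = Dinc₀ * max 1 (max Qro (max (4 * Q'₀) (2 * τ₀ * ψ₀ * Q'₀))) →
      Atot = Aro + Cinc₀ * (A'₀ * (4 * σ₀ * lam * Q'₀ / (1 - 4 * σ₀ * lam * Q'₀)) +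
        exp 1 * (τ₀ * (ι₁₀' * lam + ι₂₀ / (2 * Q'₀) + ι₃₀ / (4 * Q'₀ ^ 2) + A'₀ * Q'₀ / 4)) *
          (Φ₀ * (τ₀ * (ι₁₀' * lam + ι₂₀ / (2 * Q'₀) + ι₃₀ / (4 * Q'₀ ^ 2) + A'₀ * Q'₀ / 4)) /
            (1 - Φ₀ * (τ₀ * (ι₁₀' * lam + ι₂₀ / (2 * Q'₀) + ι₃₀ / (4 * Q'₀ ^ 2) + A'₀ * Q'₀ / 4)))) / (2 * τ₀ * Q'₀)) →
      Qtot * imagTimeWeight β M ^ 2 * Bf * max 1 (Atot / imagTimeWeight β M) ≤ CEf₀) ∧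
    -- (iii) the DOMINATION of the base read-out constants (constants `Cinc₁ Dinc₁`) by the amplitudes-to-be `aT₁·(β/M)/Bf²`, `qT₁·(M/β)²`
    (∀ lam ι₁₀' : ℝ, 0 ≤ lam → lam ≤ uf₀ → 0 ≤ ι₁₀' → ι₁₀' * lam ≤ ((M : ℝ) / β) / Bf → ∀ (Aro Qro Qtot Atot : ℝ), Aro = Cinc₁ * Ab₀ → Qro = Dinc₁ * Qb₀ →
      Qtot = Dinc₁ * max 1 (max Qro (max (4 * Q'₀) (2 * τ₀ * ψ₀ * Q'₀))) →
      Atot = Aro + Cinc₁ * (A'₀ * (4 * σ₀ * lam * Q'₀ / (1 - 4 * σ₀ * lam * Q'₀)) +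
        exp 1 * (τ₀ * (ι₁₀' * lam + ι₂₀ / (2 * Q'₀) + ι₃₀ / (4 * Q'₀ ^ 2) + A'₀ * Q'₀ / 4)) *
          (Φ₀ * (τ₀ * (ι₁₀' * lam + ι₂₀ / (2 * Q'₀) + ι₃₀ / (4 * Q'₀ ^ 2) + A'₀ * Q'₀ / 4)) /
            (1 - Φ₀ * (τ₀ * (ι₁₀' * lam + ι₂₀ / (2 * Q'₀) + ι₃₀ / (4 * Q'₀ ^ 2) + A'₀ * Q'₀ / 4)))) / (2 * τ₀ * Q'₀)) →
      Atot ≤ aT₁ * (β / M) / Bf ^ 2 ∧ Qtot ≤ qT₁ * ((M : ℝ) / β) ^ 2) := by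
  -- §0 positivity of the r-free closed forms
  have he0 : (0 : ℝ) < klE0 := by norm_num [klE0]
  have hW₀₀0 : 0 < W₀₀ := by rw [hW₀₀]; positivity
  have hZ₀₀0 : 0 < Z₀₀ := by rw [hZ₀₀]; positivity
  have hs₀₀0 : 0 < s₀₀ := by rw [hs₀₀]; positivity
  have ht₀₀0 : 0 < t₀₀ := by rw [ht₀₀]; positivity
  have hp₀₀0 : 0 < p₀₀ := by rw [hp₀₀]; positivity
  have hφ₀₀0 : 0 < φ₀₀ := by rw [hφ₀₀]; positivity
  have hQL₀0 : 0 < QL₀ := by rw [hQL₀]; positivity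
  have hQH₀0 : 0 < QH₀ := by rw [hQH₀]; positivity
  have haP₀0 : 0 < aP₀ := by rw [haP₀]; positivity
  have hsC₀0 : 0 ≤ sC₀ := by rw [hsC₀]; positivity
  have hΘ₀0 : 0 ≤ Θ₀ := by rw [hΘ₀]; positivity
  have huf₀0 : 0 < uf₀ := by rw [huf₀]; positivity
  have hC₁0 : 0 < Cinc₁ := lt_of_lt_of_le one_pos hCinc₁
  have hD₀0 : 0 ≤ Dinc₀ := le_trans zero_le_one hDinc₀
  have hD₁0 : 0 < Dinc₁ := lt_of_lt_of_le one_pos hDinc₁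
  have haT₀0 : 0 ≤ aT₀ := by rw [haT₀]; positivity
  have haT₁0 : 0 < aT₁ := by rw [haT₁]; positivity
  have hqT₀0 : 0 ≤ qT₀ := by rw [hqT₀]; positivity
  have hqT₁0 : 0 < qT₁ := by rw [hqT₁]; positivity
  have hBf0 : 0 < Bf := lt_of_lt_of_le one_pos hBf1
  have hCEf₀0 : 0 ≤ CEf₀ := by rw [hCEf₀]; exact mul_nonneg (mul_nonneg hqT₀0 hBf0.le) (le_trans zero_le_one (le_max_left _ _))
  have he1 : (1 : ℝ) ≤ exp 1 := Real.one_le_exp (by norm_num)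
  -- the two-leg slot is absorbed by `Bf`: `4φ₀₀t₀₀(1 + ŝC₀) ≤ Bf` and `4e·φ₀₀t₀₀ ≤ Bf`
  have hBfs : 4 * φ₀₀ * t₀₀ * (1 + sC₀) ≤ Bf := by
    have h0 : 0 ≤ 4 * φ₀₀ * t₀₀ * (1 + sC₀) := by positivity
    calc 4 * φ₀₀ * t₀₀ * (1 + sC₀) = 4 * φ₀₀ * t₀₀ * (1 + sC₀) * 1 := (mul_one _).symm
      _ ≤ 4 * φ₀₀ * t₀₀ * (1 + sC₀) * exp 1 := mul_le_mul_of_nonneg_left he1 h0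
      _ = 4 * exp 1 * φ₀₀ * t₀₀ * (1 + sC₀) := by ring
      _ ≤ Bf := hBf₀
  have hBfe : exp 1 * φ₀₀ * t₀₀ * (1 / Bf) ≤ 1 / 4 := by
    rw [mul_one_div, div_le_iff₀ hBf0]
    have h0 : 0 ≤ exp 1 * φ₀₀ * t₀₀ * sC₀ := by positivity
    calc exp 1 * φ₀₀ * t₀₀ = (4 * exp 1 * φ₀₀ * t₀₀ * (1 + sC₀) - 4 * (exp 1 * φ₀₀ * t₀₀ * sC₀)) / 4 := by ring
      _ ≤ (Bf - 0) / 4 := by gcongr; linarith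
      _ = 1 / 4 * Bf := by ring
  -- `uf₀` below each of its members
  have huf1 : uf₀ ≤ 1 := by rw [huf₀]; exact min_le_left _ _
  have huf2 : uf₀ ≤ 1 / (8 * s₀₀ * QH₀ + 1) := by rw [huf₀]; exact (min_le_right _ _).trans (min_le_left _ _)
  have huf3 : uf₀ ≤ 1 / (2 * exp 1 * t₀₀ * QH₀ + 1) := by rw [huf₀]; exact (min_le_right _ _).trans ((min_le_right _ _).trans (min_le_left _ _))
  have huf5 : uf₀ ≤ 1 / (4 * Θ₀ + 1) := by rw [huf₀]; exact (min_le_right _ _).trans ((min_le_right _ _).trans (min_le_right _ _))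
  refine ⟨huf₀0, haT₁0, hqT₁0, hCEf₀0, ?_⟩
  -- §1 the binders
  intro β M _ hβ hβM Ab₀ Qb₀ ι₂₀ hAb₀ hQb₀ hι₂₀0 hι₂₀ κb₀ αb₀ crb₀ ccb₀ hκb₀ hαb₀ hcrb₀ hccb₀
    W₀ Z₀ σ₀ Φ₀ ψ₀ τ₀ hW₀ hZ₀ hσ₀ hΦ₀ hψ₀ hτ₀ A'₀ Q'₀ ι₃₀ hA'₀ hQ'₀ hι₃₀
  have hM0 : (0 : ℝ) < M := Nat.cast_pos.2 (Nat.pos_of_ne_zero (NeZero.ne M))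
  have hβ0 : β ≠ 0 := hβ.ne'
  have hMne : (M : ℝ) ≠ 0 := hM0.ne'
  set r : ℝ := β / M with hr
  have hr0 : 0 < r := by positivity
  have hr1 : r ≤ 1 := by rw [hr, div_le_one hM0]; exact hβM
  have hMβ : (M : ℝ) / β = 1 / r := by rw [hr]; field_simp
  have hMβ2 : ((M : ℝ) / β) ^ 2 = 1 / r ^ 2 := by rw [hMβ]; field_simp
  have hitw : imagTimeWeight β M = r / 2 := by rw [imagTimeWeight, hr]; field_simp
  -- §2 the pins in closed form, then eliminate `W₀ Z₀ σ₀ Φ₀ ψ₀ τ₀`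
  have hW' : W₀ = W₀₀ := by rw [hW₀₀]; exact levPin_W hCJ₀.ne' hβ0 hMne hcrb₀ hccb₀ hW₀
  have hZ' : Z₀ = Z₀₀ := by rw [hZ₀₀]; exact levPin_Z hβ0 hMne hccb₀ hZ₀
  have hσ' : σ₀ = s₀₀ * r ^ 2 := by rw [hs₀₀, hr]; exact levPin_σ hCκ₀ hCJ₀.ne' hβ0 hMne hκb₀ hccb₀ hσ₀
  have hτ' : τ₀ = t₀₀ * r ^ 2 := by rw [ht₀₀, hr]; exact levPin_τ hCκ₀ hCJ₀.ne' hβ0 hMne hκb₀ hccb₀ hτ₀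
  have hψ' : ψ₀ = p₀₀ / r ^ 2 := by rw [levPin_ψ hCκ₀ hCJ₀.ne' hβ0 hMne hκb₀ hccb₀ hψ₀, hMβ2, hp₀₀]; ring
  have hΦ' : Φ₀ = φ₀₀ / r := by rw [levPin_Φ hCκ₀ hCJ₀.ne' hβ0 hMne hκb₀ hαb₀ hcrb₀ hccb₀ hΦ₀, hMβ, hφ₀₀]; ring
  clear hW₀ hZ₀ hσ₀ hτ₀ hψ₀ hΦ₀
  subst W₀ Z₀ σ₀ Φ₀ ψ₀ τ₀
  have hΦ0 : 0 ≤ φ₀₀ / r := by positivity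
  have hτ0 : 0 ≤ t₀₀ * r ^ 2 := by positivity
  -- §3 the shaped data
  have hAb₀0 : 0 ≤ Ab₀ := by rw [hAb₀]; positivity
  have hQb2 : Qb₀ = qb₀ / r ^ 2 := by rw [hQb₀, hMβ2]; ring
  have hQb₀0 : 0 ≤ Qb₀ := by rw [hQb2]; positivity
  have hQbhi : Qb₀ ≤ qb₀ / r ^ 2 := le_of_eq hQb2
  have hr2 : 0 < r ^ 2 := by positivity
  have hQ'₁ : QL₀ / r ^ 2 ≤ Q'₀ := by rw [hQ'₀, hQL₀, hQb2]; rw [mul_div_assoc]; linarith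
  have hZQb : 0 ≤ Z₀₀ * Qb₀ := by positivity
  have hQ'1 : 1 ≤ Q'₀ := by rw [hQ'₀]; linarith
  have hQ'₂ : Q'₀ ≤ QH₀ / r ^ 2 := by
    have h1 : (1 : ℝ) ≤ 1 / r ^ 2 := by rw [le_div_iff₀ hr2, one_mul]; exact pow_le_one₀ hr0.le hr1
    rw [hQ'₀, hQH₀, hQb2, add_div, mul_div_assoc]; linarith
  have hQ'0 : 0 < Q'₀ := lt_of_lt_of_le one_pos hQ'1
  have hZQ : Z₀₀ * Qb₀ ≤ Q'₀ := by rw [hQ'₀]; linarith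
  have hZQ3 : Z₀₀ ^ 3 * Qb₀ ^ 3 ≤ Q'₀ ^ 3 := by rw [← mul_pow]; exact pow_le_pow_left₀ hZQb hZQ 3
  have hA'eq : A'₀ = aP₀ * r / Bf ^ 2 := by rw [hA'₀, haP₀, hAb₀]; ring
  have hA'0 : 0 ≤ A'₀ := by rw [hA'eq]; positivity
  have hA'le : A'₀ ≤ aP₀ * r / Bf ^ 2 := le_of_eq hA'eq
  have hA'le' : A'₀ ≤ aP₀ * r := by rw [hA'eq]; exact div_le_self (by positivity) (one_le_pow₀ hBf1)
  have hι₂' : ι₂₀ ≤ i₂₀ / (Bf * r ^ 3) := by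
    have : ((M : ℝ) / β) ^ 3 = 1 / r ^ 3 := by rw [hMβ]; field_simp
    rw [this] at hι₂₀
    refine hι₂₀.trans (le_of_eq ?_)
    field_simp
  have hι₂'' : ι₂₀ ≤ i₂₀ / r ^ 3 := hι₂'.trans (div_le_div_of_nonneg_left hi₂₀ (by positivity) (le_mul_of_one_le_left (by positivity) hBf1))
  have hQr' : Q'₀ * r ^ 2 ≤ QH₀ := (le_div_iff₀ hr2).1 hQ'₂
  have hι₃0 : 0 ≤ ι₃₀ := by rw [hι₃₀]; positivity
  have hι₃' : ι₃₀ ≤ aP₀ * QH₀ ^ 3 / (Bf ^ 2 * r ^ 5) := by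
    rw [hι₃₀, le_div_iff₀ (by positivity)]
    have hQ3 : (Q'₀ * r ^ 2) ^ 3 ≤ QH₀ ^ 3 := pow_le_pow_left₀ (by positivity) hQr' 3
    have hA'r : A'₀ * Bf ^ 2 ≤ aP₀ * r := (le_div_iff₀ (by positivity)).1 hA'le
    refine le_of_mul_le_mul_right ?_ hr0
    calc A'₀ * Q'₀ ^ 3 * (Bf ^ 2 * r ^ 5) * r = A'₀ * Bf ^ 2 * (Q'₀ * r ^ 2) ^ 3 := by ring
      _ ≤ aP₀ * r * QH₀ ^ 3 := mul_le_mul hA'r hQ3 (by positivity) (by positivity)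
      _ = aP₀ * QH₀ ^ 3 * r := by ring
  have hι₃'' : ι₃₀ ≤ aP₀ * QH₀ ^ 3 / r ^ 5 :=
    hι₃'.trans (div_le_div_of_nonneg_left (by positivity) (by positivity) (le_mul_of_one_le_left (by positivity) (one_le_pow₀ hBf1)))
  -- the product bound on the two-leg slot, in the two forms the helpers want
  have hprod_of : ∀ {ι lam : ℝ}, ι * lam ≤ ((M : ℝ) / β) / Bf → ι * lam ≤ 1 / (Bf * r) ∧ ι * lam ≤ (1 / Bf) / r := by
    intro ι lam h
    rw [hMβ] at h
    have e1 : (1 : ℝ) / r / Bf = 1 / (Bf * r) := by rw [div_div, mul_comm]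
    have e2 : (1 : ℝ) / Bf / r = 1 / (Bf * r) := by rw [div_div]
    exact ⟨e1 ▸ h, e2.symm ▸ e1 ▸ h⟩
  refine ⟨⟨hAb₀0, hQb₀0, hA'0, hQ'0, hZQ, hι₃0, hZQ3, hΦ0, hτ0, hW₀₀0, hZ₀₀0⟩, ?_, ?_, ?_⟩
  -- (i) the five smallness rows
  · intro lam ι₁₀ hlam0 hlamuf hι₁₀0 hprod
    obtain ⟨hprod1, hprod2⟩ := hprod_of hprod
    have hlam1 : lam ≤ 1 := hlamuf.trans huf1
    obtain ⟨_, hx₁⟩ := levNum_x₁_le hr0 hs₀₀0.le rfl hQ'0 hQ'₂ hlam0 (hlamuf.trans huf2)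
    obtain ⟨_, hx₃, hx₂⟩ := levNum_x₃_le hr0 ht₀₀0.le rfl hQ'0 hQ'₂ hlam0 (hlamuf.trans huf3)
    have hS := levNum_S₀_le' hr0 hBf1 hQL₀0 hlam0 hprod1 hι₂₀0 hι₂' hι₃0 hι₃' hA'0 hA'le hQ'₁ hQ'₂
    have hS2 : ι₁₀ * lam + ι₂₀ / (2 * Q'₀) + ι₃₀ / (4 * Q'₀ ^ 2) + A'₀ * Q'₀ / 4 ≤ (0 * lam + (1 + sC₀)) / (Bf * r) := by
      rw [hsC₀]; exact hS.trans (le_of_eq (by ring))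
    have hS0 : 0 ≤ ι₁₀ * lam + ι₂₀ / (2 * Q'₀) + ι₃₀ / (4 * Q'₀ ^ 2) + A'₀ * Q'₀ / 4 := by positivity
    obtain ⟨_, hy⟩ := levNum_y₀_le hr0 ht₀₀0.le hφ₀₀0.le hBf1 rfl rfl hS0 hS2 le_rfl hlam0 (by rw [mul_zero, zero_add, div_one]; exact hlam1) hBfs
    obtain ⟨_, _, hθ⟩ := levNum_θ₀_le' hr0 ht₀₀0.le hφ₀₀0.le rfl rfl hι₁₀0 hprod2 hι₂₀0 hι₂'' hι₃0 hι₃'' hA'0 hA'le' hQ'0 hQ'₂ hlam0 hlam1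
      hx₃ hΘ₀
    exact ⟨by linarith, hx₂, by linarith, by linarith, by linarith [hθ hBfe (hlamuf.trans huf5)]⟩
  -- (ii) the CE row
  · intro lam ι₁₀ hlam0 hlamuf hι₁₀0 hprod Aro Qro Qtot Atot hAro hQro hQtot hAtot
    obtain ⟨hprod1, _⟩ := hprod_of hprod
    have hlam1 : lam ≤ 1 := hlamuf.trans huf1
    obtain ⟨_, hx₁⟩ := levNum_x₁_le hr0 hs₀₀0.le rfl hQ'0 hQ'₂ hlam0 (hlamuf.trans huf2)
    have hS := levNum_S₀_le' hr0 hBf1 hQL₀0 hlam0 hprod1 hι₂₀0 hι₂' hι₃0 hι₃' hA'0 hA'le hQ'₁ hQ'₂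
    have hS2 : ι₁₀ * lam + ι₂₀ / (2 * Q'₀) + ι₃₀ / (4 * Q'₀ ^ 2) + A'₀ * Q'₀ / 4 ≤ (0 * lam + (1 + sC₀)) / (Bf * r) := by
      rw [hsC₀]; exact hS.trans (le_of_eq (by ring))
    have hS0 : 0 ≤ ι₁₀ * lam + ι₂₀ / (2 * Q'₀) + ι₃₀ / (4 * Q'₀ ^ 2) + A'₀ * Q'₀ / 4 := by positivity
    have hS' : ι₁₀ * lam + ι₂₀ / (2 * Q'₀) + ι₃₀ / (4 * Q'₀ ^ 2) + A'₀ * Q'₀ / 4 ≤ (1 + sC₀) / (Bf * r) :=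
      hS2.trans (le_of_eq (by ring))
    obtain ⟨_, hy⟩ := levNum_y₀_le hr0 ht₀₀0.le hφ₀₀0.le hBf1 rfl rfl hS0 hS2 le_rfl hlam0 (by rw [mul_zero, zero_add, div_one]; exact hlam1) hBfs
    have hAt := levNum_Atot₀_le (i₁ := 1) hr0 ht₀₀0 hφ₀₀0.le hBf1 rfl rfl hQL₀0 hQ'₁ hS0 hS' hx₁ hy hA'0 hA'le hAb₀ hCinc₀.le hAro hAtot
    rw [← haT₀] at hAt
    have hAt' : Atot ≤ aT₀ * r := hAt.trans (div_le_self (by positivity) (one_le_pow₀ hBf1))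
    obtain ⟨hQtot0, hQt, -⟩ := levNum_Qtot₀_le hr0 hr1 ht₀₀0.le hp₀₀0.le rfl rfl hQ'0 hQ'₂ hQb₀0 hQbhi hDinc₀ hQro hQtot
    rw [← hqT₀] at hQt
    rw [hitw, hCEf₀]
    exact levNum_CErow_le hr0 hBf1 hQtot0 hQt hAt'
  -- (iii) the domination
  · intro lam ι₁₀ hlam0 hlamuf hι₁₀0 hprod Aro Qro Qtot Atot hAro hQro hQtot hAtot
    obtain ⟨hprod1, _⟩ := hprod_of hprod
    have hlam1 : lam ≤ 1 := hlamuf.trans huf1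
    obtain ⟨_, hx₁⟩ := levNum_x₁_le hr0 hs₀₀0.le rfl hQ'0 hQ'₂ hlam0 (hlamuf.trans huf2)
    have hS := levNum_S₀_le' hr0 hBf1 hQL₀0 hlam0 hprod1 hι₂₀0 hι₂' hι₃0 hι₃' hA'0 hA'le hQ'₁ hQ'₂
    have hS2 : ι₁₀ * lam + ι₂₀ / (2 * Q'₀) + ι₃₀ / (4 * Q'₀ ^ 2) + A'₀ * Q'₀ / 4 ≤ (0 * lam + (1 + sC₀)) / (Bf * r) := by
      rw [hsC₀]; exact hS.trans (le_of_eq (by ring))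
    have hS0 : 0 ≤ ι₁₀ * lam + ι₂₀ / (2 * Q'₀) + ι₃₀ / (4 * Q'₀ ^ 2) + A'₀ * Q'₀ / 4 := by positivity
    have hS' : ι₁₀ * lam + ι₂₀ / (2 * Q'₀) + ι₃₀ / (4 * Q'₀ ^ 2) + A'₀ * Q'₀ / 4 ≤ (1 + sC₀) / (Bf * r) :=
      hS2.trans (le_of_eq (by ring))
    obtain ⟨_, hy⟩ := levNum_y₀_le hr0 ht₀₀0.le hφ₀₀0.le hBf1 rfl rfl hS0 hS2 le_rfl hlam0 (by rw [mul_zero, zero_add, div_one]; exact hlam1) hBfs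
    have hAt := levNum_Atot₀_le (i₁ := 1) hr0 ht₀₀0 hφ₀₀0.le hBf1 rfl rfl hQL₀0 hQ'₁ hS0 hS' hx₁ hy hA'0 hA'le hAb₀ hC₁0.le hAro hAtot
    rw [← haT₁] at hAt
    obtain ⟨-, -, hQt⟩ := levNum_Qtot₀_le hr0 hr1 ht₀₀0.le hp₀₀0.le rfl rfl hQ'0 hQ'₂ hQb₀0 hQbhi hDinc₁ hQro hQtot
    refine ⟨hAt, ?_⟩
    rw [hMβ2, ← hqT₁] at *
    calc Qtot ≤ qT₁ / r ^ 2 := hQt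
      _ = qT₁ * (1 / r ^ 2) := by ring

end Summit.HubbardSuperconductivity.HubbardSuperconductivity.Theorems.EngineV8

end
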